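import Mathlib
import Literature.NumberTheory.LFunctions.Zhang2022.TypedSection04B
import Literature.NumberTheory.LFunctions.Zhang2022.Section4Lemma41
import Literature.NumberTheory.LFunctions.Zhang2022.Section4Lemma42Holds
import Literature.NumberTheory.LFunctions.Zhang2022.Section4Eq410Edge
import Literature.NumberTheory.LFunctions.Zhang2022.Section4Lemma43Edge
import Literature.NumberTheory.LFunctions.Zhang2022.Section2Lemma23Inputs
import HarnessLib

/-!
# Zhang (2022) §4 p. 21 (tex L1129–L1143): the `𝒜`-paragraph, kernel-checked — `𝒜(s,ψ)` is
# analytic in `Ω₁` with the zeros of `L(s,ψ)L(s,ψχ)` (Z22:§4.u038), `F(s,ψ)⁻¹ ≪ 𝓛⁷⁹` outright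
# (Z22:§4.u039), and the printed deduction of (4.10) (Z22:(4.10), edge `Ded410`)

Topic `Literature/NumberTheory/LFunctions/Zhang2022` (Landau–Siegel adjudication tree;
verdict-neutral). Y. Zhang, *Discrete mean estimates and the Landau–Siegel zero*,
arXiv:2211.02515v1 (2022) [Zhang2022LandauSiegel] — **an unrefereed manuscript under adjudication;
nothing in this file asserts or denies its Theorems 1–2 or says anything about Landau–Siegel zeros.**
Cell siegel-zhang (D-0069), layer L1, row `TypedSection04B` (typer L1-t6; this discharge file: L1-t1).

Source text [Z22 p. 21, tex L1129–L1138]: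

> In order to prove Proposition 2.2, it is appropriate to deal with the function
> `𝒜(s,ψ) = L(s,ψ)L(s,ψχ)/F(s,ψ)`. By Lemma 4.2, `𝒜(s,ψ)` is analytic and it has the same zeros as
> `L(s,ψ)L(s,ψχ)` in `Ω₁`. Further, for `s ∈ Ω₁`, we have `F(s,ψ)⁻¹ ≪ 𝓛⁷⁹` by Lemma 4.1 and 4.2.
> This together with Lemma 4.4 implies that `𝒜(s,ψ) = 1 + ℬ(s,ψ) + O(𝓛⁻¹⁰⁰)` (4.10).

The three CLAIM nodes of `TypedSection04B.lean` (`Section4.Step4u038`, `Section4.Step4u039`,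
`Section4.Ded410`; typed by L1-t6, cited BY NAME, not restated) are PROVED here:

* `Section4.step4u038_holds : Step4u038` — OUTRIGHT. As printed: Lemma 4.2 (a theorem of the tree,
  `Skeleton.lemma42_holds`, file `Section4Lemma42Holds`) gives `|F(s,ψ)G(s,ψ) − 1| ≤ C𝓛⁻²²⁷ ≤ 1/2`
  on `Ω₁` for `D` large and `ψ ∈ Ψ₁`, hence `F(s,ψ) ≠ 0` there
  (`Skeleton.inv_norm_le_two_mul_of_norm_mul_sub_one_le`); so `𝒜 = LL/F` is holomorphic on the OPEN
  set `Ω₁` (`isOpen_Omega1`; `LL` entire by `Skeleton.differentiable_LL`, `F` entire by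
  `Skeleton.differentiable_Fpoly`), i.e. analytic there, and `𝒜(s,ψ) = 0 ↔ L(s,ψ)L(s,ψχ) = 0`.
* `Section4.step4u039_holds : Step4u039` — OUTRIGHT: L1-t6's kernel edge `Section4.step4u039_of`
  fed with the tree's `Skeleton.lemma41_holds`, `Skeleton.lemma42_holds`.
* `Section4.ded410_holds : Ded410` — the printed deduction "Lemmas 4.1, 4.2, 4.4 (+ `F⁻¹ ≪ 𝓛⁷⁹`)
  ⇒ (4.10)", by sz-d12's kernel edge `Skeleton.eq410_of : Lemma41 → Lemma42 → Lemma44 → Eq410`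
  (file `Section4Eq410Edge`; the `Step4u039` antecedent is subsumed by Lemmas 4.1–4.2).

No new definitions, no named facts (D-0026), no numerics.

## References

* Y. Zhang, arXiv:2211.02515v1 (2022), §4 p. 21 (tex L1129–L1143).
  [cite: Zhang2022LandauSiegel, §4 p.21]
-/

noncomputable section

open Complex Real
open Literature.NumberTheory.LFunctions.Zhang2022
open Literature.NumberTheory.LFunctions.Zhang2022.Skeleton

namespace Literature.NumberTheory.LFunctions.Zhang2022.Section4

/-! ## Small inputs -/

/-- `𝓛 ≥ K` eventually, for any fixed real `K` (`𝓛 = log D`, (2.1)).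
[cite: Zhang2022LandauSiegel, §2 (2.1)] -/
private theorem forAllLarge_le_ell' (K : ℝ) : ForAllLarge fun D _ _ => K ≤ ell D := by
  refine ⟨⌈Real.exp K⌉₊, fun D _ χ hD _ _ => ?_⟩
  have hD' : Real.exp K ≤ D := le_trans (Nat.le_ceil _) (by exact_mod_cast hD)
  exact (Real.le_log_iff_exp_le (lt_of_lt_of_le (Real.exp_pos K) hD')).mpr hD'

/-- `D ≥ 3` eventually. [cite: Zhang2022LandauSiegel, §2 p. 4] -/
private theorem forAllLarge_three_le : ForAllLarge fun D _ _ => 3 ≤ D :=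
  ⟨3, fun _ _ _ hD _ _ => hD⟩

/-- **`Ω₁` is open**: `Ω₁ = {1/2 − (100𝓛)⁻¹log 𝓛 < σ < 1 + (100𝓛)⁻¹log 𝓛, |t − 2πt₀| < 𝓛₁ + 5}`
(Lemma 4.1, §4 p. 16) is cut out by strict inequalities in `Re s`, `Im s`.
[cite: Zhang2022LandauSiegel, §4 Lemma 4.1 p.16] -/
theorem isOpen_Omega1 (D : ℕ) : IsOpen (Omega1 D) := by
  have h1 : IsOpen {s : ℂ | 1 / 2 - Real.log (ell D) / (100 * ell D) < s.re} :=
    isOpen_lt continuous_const Complex.continuous_re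
  have h2 : IsOpen {s : ℂ | s.re < 1 + Real.log (ell D) / (100 * ell D)} :=
    isOpen_lt Complex.continuous_re continuous_const
  have h3 : IsOpen {s : ℂ | |s.im - 2 * Real.pi * t0 D| < ell1 D + 5} :=
    isOpen_lt (by fun_prop) continuous_const
  have h := h1.and (h2.and h3)
  simpa [Omega1, Lemma43.Omega1, Set.setOf_and] using h

/-! ## Z22:§4.u038 — `𝒜(s,ψ)` analytic in `Ω₁` with the zeros of `L(s,ψ)L(s,ψχ)` -/

/-- **Z22:§4.u038 HOLDS** [Z22 p.21, tex L1133] «By Lemma 4.2, `𝒜(s,ψ)` is analytic and it has the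
same zeros as `L(s,ψ)L(s,ψχ)` in `Ω₁`» (`ψ ∈ Ψ₁`): the node `Section4.Step4u038` of
`TypedSection04B`, PROVED outright from the tree's Lemma 4.2 (`Skeleton.lemma42_holds`): for `D`
beyond Lemma 4.2's threshold with `2C₄₂ ≤ 𝓛` one has `|FG − 1| ≤ C₄₂𝓛⁻²²⁷ ≤ 1/2` on `Ω₁`, so
`F(s,ψ) ≠ 0`, `𝒜 = LL/F` is holomorphic on the open set `Ω₁` and vanishes exactly where `LL` does.
[cite: Zhang2022LandauSiegel, §4 p.21] -/
theorem step4u038_holds : Step4u038 := by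
  obtain ⟨C₂, h42⟩ := Skeleton.lemma42_holds
  refine ((h42.and (forAllLarge_le_ell' (max 1 (2 * C₂)))).and forAllLarge_three_le).mono ?_
  intro D _ χ _ hp h x hx
  obtain ⟨⟨hFG, hK⟩, hD3⟩ := h
  have hℓ1 : 1 ≤ ell D := le_trans (le_max_left _ _) hK
  have hℓ0 : 0 < ell D := lt_of_lt_of_le one_pos hℓ1
  have hC₂ : 2 * C₂ ≤ ell D := le_trans (le_max_right _ _) hK
  -- `C₂ 𝓛⁻²²⁷ ≤ 1/2`
  have hsmall : C₂ * (ell D ^ 227)⁻¹ ≤ 1 / 2 := by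
    have hpow : ell D ≤ ell D ^ 227 := by
      calc ell D = ell D ^ 1 := (pow_one _).symm
        _ ≤ ell D ^ 227 := pow_le_pow_right₀ hℓ1 (by norm_num)
    rw [← div_eq_mul_inv, div_le_iff₀ (pow_pos hℓ0 _)]
    linarith
  -- `F(s,ψ) ≠ 0` on `Ω₁`
  have hF : ∀ s ∈ Omega1 D, Fpoly χ x s ≠ 0 := fun s hs =>
    (Skeleton.inv_norm_le_two_mul_of_norm_mul_sub_one_le ((hFG x hx s hs).trans hsmall)).1
  have hLL : Differentiable ℂ (LL χ x) := Skeleton.differentiable_LL χ hD3 hp x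
  have hFd : Differentiable ℂ (Fpoly χ x) := Skeleton.differentiable_Fpoly χ x
  have hcalA : calA χ x = fun s => LL χ x s / Fpoly χ x s := rfl
  refine ⟨?_, fun s hs => ?_⟩
  · rw [hcalA]
    exact (hLL.differentiableOn.div hFd.differentiableOn hF).analyticOnNhd (isOpen_Omega1 D)
  · show LL χ x s / Fpoly χ x s = 0 ↔ LL χ x s = 0
    rw [div_eq_zero_iff, or_iff_left (hF s hs)]

/-! ## Z22:§4.u039 — `F(s,ψ)⁻¹ ≪ 𝓛⁷⁹` on `Ω₁`, now unconditional -/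

/-- **Z22:§4.u039 HOLDS** [Z22 p.21, tex L1135] «for `s ∈ Ω₁`, we have `F(s,ψ)⁻¹ ≪ 𝓛⁷⁹` by
Lemma 4.1 and 4.2» (`ψ ∈ Ψ₁`): L1-t6's kernel edge `step4u039_of` composed with the tree's theorems
`Skeleton.lemma41_holds` (file `Section4Lemma41`) and `Skeleton.lemma42_holds`
(file `Section4Lemma42Holds`). [cite: Zhang2022LandauSiegel, §4 p.21] -/
theorem step4u039_holds : Step4u039 :=
  step4u039_of Skeleton.lemma41_holds Skeleton.lemma42_holds

/-! ## Z22:(4.10), the printed deduction -/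

/-- **Z22:(4.10), its printed deduction, HOLDS** [Z22 p.21, tex L1138] «This [`F⁻¹ ≪ 𝓛⁷⁹` by
Lemma 4.1 and 4.2] together with Lemma 4.4 implies that `𝒜(s,ψ) = 1 + ℬ(s,ψ) + O(𝓛⁻¹⁰⁰)` (4.10)
for `s ∈ Ω₃`»: the node `Section4.Ded410 := Lemma41 → Lemma42 → Lemma44 → Step4u039 → Eq410`,
by sz-d12's kernel edge `Skeleton.eq410_of` (file `Section4Eq410Edge`; the `Step4u039` antecedent is
re-derived inside that edge from Lemmas 4.1–4.2, so it is not consumed separately).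
[cite: Zhang2022LandauSiegel, §4 (4.10) p.21] -/
theorem ded410_holds : Ded410 := fun h41 h42 h44 _ => Skeleton.eq410_of h41 h42 h44

end Literature.NumberTheory.LFunctions.Zhang2022.Section4

end
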